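import Literature.MeasureTheory.Group.InvariantQuotientChainRule
import Literature.MeasureTheory.Group.InvariantQuotientUniqueness
import Literature.MeasureTheory.Group.InvariantQuotientExistence
import HarnessLib

/-!
# Integration in stages with a compact fibre:
`∫_{G ⧸ H} ψ ∘ π dμ_{G/H} = v ∫_{G ⧸ L} ψ dμ_{G/L}` for `L ⧸ (H ⊓ L)` compact
(Gelbart, *Automorphic forms on adele groups* (1975), (9.13) and Remark 9.23: the passage
`∫_{Γ(γ)\G} F = vol(Γ(γ)\G_γ) ∫_{G_γ\G} F`; Bourbaki, *Intégration* VII §2 no. 8)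

Topic `MeasureTheory/Group`; companion to `InvariantQuotientDiscreteFibre` (discrete fibre) and a
corollary of the **uniqueness** of invariant measures on coset spaces
(`InvariantQuotientUniqueness.smulInvariantMeasure_quotient_unique_ne_zero`). Let `H ≤ L ≤ G` be
closed subgroups of a locally compact second countable Hausdorff group and
`π : G ⧸ H → G ⧸ L` the canonical `G`-map (Mathlib `Subgroup.quotientMapOfLE`). When the fibre
`L ⧸ (H ⊓ L)` is **compact**, `π` pulls compact sets back into compact sets
(`exists_isCompact_preimage_quotientMapOfLE_subset`), so the push-forward `π_* μ_{G/H}` of a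
`G`-invariant Borel measure finite on compact sets is again such a measure
(`smulInvariantMeasure_map_quotientMapOfLE`, `isFiniteMeasureOnCompacts_map_quotientMapOfLE`);
by uniqueness it is a positive multiple of any given non-zero one:

  `π_* μ_{G/H} = v • μ_{G/L}`, `v ∈ (0, ∞)`  (`exists_map_quotientMapOfLE_eq_smul`),

whence `∫_{G ⧸ H} ψ(π x) dμ_{G/H} = v ∫_{G ⧸ L} ψ dμ_{G/L}` for Borel `ψ ≥ 0`
(`lintegral_comp_quotientMapOfLE_eq`) and for Bochner integrands (`integral_comp_quotientMapOfLE_eq`).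
The constant `v` plays the role of the volume of the compact fibre. A convenient criterion for the
compactness of the fibre is `compactSpace_quotient_subgroupOf_of_subset_mul` (`L ⊆ K · H` for a
compact `K ⊆ L`). Theorems only.

This is the measure-theoretic step `∫_{A Γ_γ \ G} = vol · ∫_{G_γ \ G}` in the trace formula for a
compact quotient (Gelbart (1975), (9.13), Remark 9.23, with `H = A_G · G(K)_γ ≤ L = G_γ(𝔸)`,
`L ⧸ H` compact); part of the inline (D-0026) decomposition of
`Literature.NumberTheory.Automorphic.strong_multiplicity_one_quaternionUnits`.

## References

* S. Gelbart, *Automorphic forms on adele groups*, Ann. of Math. Studies 83 (1975), §9,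
  (9.13), Remark 9.23 [Gelbart1975].
* J. R. Getz, H. Hahn, *An Introduction to Automorphic Representations* (2024), Thm. 3.2.2
  (uniqueness of the invariant measure) [GetzHahn2024]; N. Bourbaki, *Intégration*, Ch. VII §2
  no. 8.
-/

noncomputable section

open _root_.MeasureTheory _root_.MeasureTheory.Measure _root_.Topology Set Filter
open scoped ENNReal NNReal Pointwise

/- Work with Borel structures on the coset spaces, as in `InvariantQuotientChainRule`. -/
attribute [-instance] Quotient.instMeasurableSpace QuotientGroup.measurableSpace

namespace Literature.MeasureTheory.Group

/-! ### The fibration `G ⧸ H → G ⧸ L` -/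

section Map

variable {G : Type*} [Group G] [TopologicalSpace G] [IsTopologicalGroup G] (H L : Subgroup G)

omit [TopologicalSpace G] [IsTopologicalGroup G] in
/-- The canonical map `G ⧸ H → G ⧸ L` (`H ≤ L`) is `G`-equivariant. [folklore] -/
theorem quotientMapOfLE_const_smul (hHL : H ≤ L) (g : G) (x : G ⧸ H) :
    Subgroup.quotientMapOfLE hHL (g • x) = g • Subgroup.quotientMapOfLE hHL x := by
  induction x using QuotientGroup.induction_on
  rfl

omit [TopologicalSpace G] [IsTopologicalGroup G] in
/-- **The fibres of `G ⧸ H → G ⧸ L` are translates of `L ⧸ (H ⊓ L)`**: if `C ⊆ G ⧸ L` is covered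
by the classes of `K ⊆ G`, then `π⁻¹(C)` is covered by `{k • ℓH : k ∈ K, ℓ ∈ L}`. [folklore] -/
theorem preimage_quotientMapOfLE_subset (hHL : H ≤ L) {C : Set (G ⧸ L)} {K : Set G}
    (hK : C ⊆ QuotientGroup.mk '' K) :
    Subgroup.quotientMapOfLE hHL ⁻¹' C ⊆
      (fun p : G × (L ⧸ H.subgroupOf L) => p.1 • inclQuot H L p.2) '' (K ×ˢ univ) := by
  intro x hx
  induction x using QuotientGroup.induction_on with
  | H g =>
    rw [mem_preimage, Subgroup.quotientMapOfLE_apply_mk] at hx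
    obtain ⟨k, hk, hkg⟩ := hK hx
    have hℓ : k⁻¹ * g ∈ L := QuotientGroup.eq.1 hkg
    refine ⟨(k, QuotientGroup.mk ⟨k⁻¹ * g, hℓ⟩), ⟨hk, mem_univ _⟩, ?_⟩
    change k • inclQuot H L (QuotientGroup.mk ⟨k⁻¹ * g, hℓ⟩) = QuotientGroup.mk g
    rw [inclQuot_mk, MulAction.Quotient.smul_mk, smul_eq_mul, mul_inv_cancel_left]

/-- **Compact fibre ⇒ `π : G ⧸ H → G ⧸ L` pulls compact sets back into compact sets** (`G`
locally compact, so that compact subsets of `G ⧸ L` lift to compact subsets of `G`,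
`exists_isCompact_image_mk_superset`). [folklore] -/
theorem exists_isCompact_preimage_quotientMapOfLE_subset [LocallyCompactSpace G] (hHL : H ≤ L)
    [CompactSpace (L ⧸ H.subgroupOf L)] {C : Set (G ⧸ L)} (hC : IsCompact C) :
    ∃ K' : Set (G ⧸ H), IsCompact K' ∧ Subgroup.quotientMapOfLE hHL ⁻¹' C ⊆ K' := by
  obtain ⟨K, hK, hCK⟩ := exists_isCompact_image_mk_superset L hC
  exact ⟨_, (hK.prod isCompact_univ).image
    (continuous_fst.smul ((continuous_inclQuot H L).comp continuous_snd)),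
    preimage_quotientMapOfLE_subset H L hHL hCK⟩

omit [IsTopologicalGroup G] in
/-- **A criterion for the compactness of the fibre**: if `L ⊆ K · H` for a compact `K ⊆ L`
(`L` closed), then `L ⧸ (H ⊓ L)` is compact. [folklore] -/
theorem compactSpace_quotient_subgroupOf_of_subset_mul (hL : IsClosed (L : Set G)) {K : Set G}
    (hK : IsCompact K) (hKL : K ⊆ L) (hLK : (L : Set G) ⊆ K * (H : Set G)) :
    CompactSpace (L ⧸ H.subgroupOf L) := by
  refine ⟨?_⟩
  have hK' : IsCompact ((Subtype.val : L → G) ⁻¹' K) :=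
    hL.isClosedEmbedding_subtypeVal.isCompact_preimage hK
  have himage : (QuotientGroup.mk : L → L ⧸ H.subgroupOf L) '' ((Subtype.val : L → G) ⁻¹' K) =
      univ := by
    refine eq_univ_of_forall fun z => ?_
    induction z using QuotientGroup.induction_on with
    | H ℓ =>
      obtain ⟨k, hk, h, hh, hkh⟩ := Set.mem_mul.1 (hLK ℓ.2)
      refine ⟨⟨k, hKL hk⟩, hk, QuotientGroup.eq.2 ?_⟩
      rw [Subgroup.mem_subgroupOf]
      change ((k : G))⁻¹ * (ℓ : G) ∈ H
      rw [← hkh, inv_mul_cancel_left]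
      exact hh
  rw [← himage]
  exact hK'.image QuotientGroup.continuous_mk

end Map

/-! ### Push-forward of an invariant measure along a fibration with compact fibre -/

section CompactFibre

variable {G : Type*} [Group G] [TopologicalSpace G] [IsTopologicalGroup G] [LocallyCompactSpace G]
  [SecondCountableTopology G] [T2Space G] [MeasurableSpace G] [BorelSpace G]
  (H L : Subgroup G) [hH : IsClosed (H : Set G)] [hL : IsClosed (L : Set G)]
  [MeasurableSpace (G ⧸ H)] [BorelSpace (G ⧸ H)] [MeasurableSpace (G ⧸ L)] [BorelSpace (G ⧸ L)]
  (μGH : Measure (G ⧸ H)) [SMulInvariantMeasure G (G ⧸ H) μGH] [IsFiniteMeasureOnCompacts μGH]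
  (μGL : Measure (G ⧸ L)) [SMulInvariantMeasure G (G ⧸ L) μGL] [IsFiniteMeasureOnCompacts μGL]

omit [LocallyCompactSpace G] [SecondCountableTopology G] [T2Space G] [MeasurableSpace G]
  [BorelSpace G] hH hL [IsFiniteMeasureOnCompacts μGH] in
/-- **The push-forward `π_* μ_{G/H}` along `π : G ⧸ H → G ⧸ L` is `G`-invariant** (`π` is
equivariant). [folklore] -/
theorem smulInvariantMeasure_map_quotientMapOfLE (hHL : H ≤ L) :
    SMulInvariantMeasure G (G ⧸ L) (μGH.map (Subgroup.quotientMapOfLE hHL)) := by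
  have hm : Measurable (Subgroup.quotientMapOfLE hHL : G ⧸ H → G ⧸ L) :=
    (continuous_quotientMapOfLE H L hHL).measurable
  refine ⟨fun g s hs => ?_⟩
  rw [Measure.map_apply hm hs, Measure.map_apply hm (measurable_const_smul g hs), ← preimage_comp]
  have hcomm : (fun x : G ⧸ L => g • x) ∘ Subgroup.quotientMapOfLE hHL =
      Subgroup.quotientMapOfLE hHL ∘ fun x : G ⧸ H => g • x :=
    funext fun x => (quotientMapOfLE_const_smul H L hHL g x).symm
  rw [hcomm, preimage_comp]
  exact SMulInvariantMeasure.measure_preimage_smul g (hm hs)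

omit [SecondCountableTopology G] [T2Space G] [MeasurableSpace G] [BorelSpace G] hH
  [SMulInvariantMeasure G (G ⧸ H) μGH] in
/-- **Compact fibre ⇒ `π_* μ_{G/H}` is finite on compact sets** (`L` closed, so that `G ⧸ L` is
Hausdorff and compact sets are Borel). [folklore] -/
theorem isFiniteMeasureOnCompacts_map_quotientMapOfLE (hHL : H ≤ L)
    [CompactSpace (L ⧸ H.subgroupOf L)] :
    IsFiniteMeasureOnCompacts (μGH.map (Subgroup.quotientMapOfLE hHL)) := by
  have hm : Measurable (Subgroup.quotientMapOfLE hHL : G ⧸ H → G ⧸ L) :=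
    (continuous_quotientMapOfLE H L hHL).measurable
  refine ⟨fun C hC => ?_⟩
  rw [Measure.map_apply hm hC.measurableSet]
  obtain ⟨K', hK', hsub⟩ := exists_isCompact_preimage_quotientMapOfLE_subset H L hHL hC
  exact (measure_mono hsub).trans_lt hK'.measure_lt_top

omit hH in
/-- **Push-forward along a fibration with compact fibre** (Gelbart (1975), (9.13)/Remark 9.23:
`∫_{Γ(γ)\G} = vol(Γ(γ)\G_γ) ∫_{G_γ\G}`; Bourbaki, *Intégration* VII §2 no. 8). Let `H ≤ L` be closed
subgroups of a locally compact second countable Hausdorff group `G` with `L ⧸ (H ⊓ L)` compact, and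
`μ_{G/H}`, `μ_{G/L}` non-zero `G`-invariant Borel measures on `G ⧸ H`, `G ⧸ L` finite on compact
sets. Then `π_* μ_{G/H} = v • μ_{G/L}` for some `v > 0` (`π : G ⧸ H → G ⧸ L` the canonical map):
the push-forward is `G`-invariant and finite on compact sets, and such measures are unique up to a
positive factor (`smulInvariantMeasure_quotient_unique_ne_zero`). [cite: Gelbart1975, (9.13)] -/
theorem exists_map_quotientMapOfLE_eq_smul (hHL : H ≤ L) [CompactSpace (L ⧸ H.subgroupOf L)]
    (hGH : μGH ≠ 0) (hGL : μGL ≠ 0) :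
    ∃ v : ℝ≥0, v ≠ 0 ∧ μGH.map (Subgroup.quotientMapOfLE hHL) = v • μGL := by
  have hm : Measurable (Subgroup.quotientMapOfLE hHL : G ⧸ H → G ⧸ L) :=
    (continuous_quotientMapOfLE H L hHL).measurable
  haveI := smulInvariantMeasure_map_quotientMapOfLE H L μGH hHL
  haveI := isFiniteMeasureOnCompacts_map_quotientMapOfLE H L μGH hHL
  have hne : μGH.map (Subgroup.quotientMapOfLE hHL) ≠ 0 := by
    intro h0
    have h1 : μGH.map (Subgroup.quotientMapOfLE hHL) univ = 0 := by rw [h0]; rfl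
    rw [Measure.map_apply hm MeasurableSet.univ, preimage_univ, measure_univ_eq_zero] at h1
    exact hGH h1
  exact smulInvariantMeasure_quotient_unique_ne_zero L _ μGL hne hGL

omit [IsTopologicalGroup G] [LocallyCompactSpace G] [SecondCountableTopology G] [T2Space G]
  [MeasurableSpace G] [BorelSpace G] hH hL [SMulInvariantMeasure G (G ⧸ H) μGH]
  [IsFiniteMeasureOnCompacts μGH] [SMulInvariantMeasure G (G ⧸ L) μGL]
  [IsFiniteMeasureOnCompacts μGL] in
/-- `∫_{G ⧸ H} ψ(π x) dμ_{G/H} = v ∫_{G ⧸ L} ψ dμ_{G/L}` for Borel `ψ : G ⧸ L → [0, ∞]`, when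
`π_* μ_{G/H} = v • μ_{G/L}` (change of variables). [folklore] -/
theorem lintegral_comp_quotientMapOfLE_eq (hHL : H ≤ L) {v : ℝ≥0}
    (hv : μGH.map (Subgroup.quotientMapOfLE hHL) = v • μGL) {ψ : G ⧸ L → ℝ≥0∞}
    (hψ : Measurable ψ) :
    ∫⁻ x, ψ (Subgroup.quotientMapOfLE hHL x) ∂μGH = v * ∫⁻ y, ψ y ∂μGL := by
  have hm : Measurable (Subgroup.quotientMapOfLE hHL : G ⧸ H → G ⧸ L) :=
    (continuous_quotientMapOfLE H L hHL).measurable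
  rw [← lintegral_map hψ hm, hv, lintegral_smul_measure, ENNReal.smul_def, smul_eq_mul]

omit [IsTopologicalGroup G] [LocallyCompactSpace G] [SecondCountableTopology G] [T2Space G]
  [MeasurableSpace G] [BorelSpace G] hH hL [SMulInvariantMeasure G (G ⧸ H) μGH]
  [IsFiniteMeasureOnCompacts μGH] [SMulInvariantMeasure G (G ⧸ L) μGL]
  [IsFiniteMeasureOnCompacts μGL] in
/-- `∫_{G ⧸ H} ψ(π x) dμ_{G/H} = v • ∫_{G ⧸ L} ψ dμ_{G/L}` for Bochner integrands `ψ` on `G ⧸ L`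
(a.e. strongly measurable; both sides vanish for non-integrable `ψ`), when
`π_* μ_{G/H} = v • μ_{G/L}`. [folklore] -/
theorem integral_comp_quotientMapOfLE_eq (hHL : H ≤ L) {v : ℝ≥0}
    (hv : μGH.map (Subgroup.quotientMapOfLE hHL) = v • μGL)
    {E : Type*} [NormedAddCommGroup E] [NormedSpace ℝ E] {ψ : G ⧸ L → E}
    (hψ : AEStronglyMeasurable ψ μGL) :
    ∫ x, ψ (Subgroup.quotientMapOfLE hHL x) ∂μGH = v • ∫ y, ψ y ∂μGL := by
  have hm : Measurable (Subgroup.quotientMapOfLE hHL : G ⧸ H → G ⧸ L) :=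
    (continuous_quotientMapOfLE H L hHL).measurable
  have hψ' : AEStronglyMeasurable ψ (μGH.map (Subgroup.quotientMapOfLE hHL)) := by
    rw [hv]; exact hψ.smul_measure v
  rw [← integral_map hm.aemeasurable hψ', hv, integral_smul_nnreal_measure]

omit hH in
/-- **Integration in stages with a compact fibre** (the printed form): under the hypotheses of
`exists_map_quotientMapOfLE_eq_smul` there is `v ∈ (0, ∞)` with
`∫_{G ⧸ H} ψ(π x) dμ_{G/H} = v ∫_{G ⧸ L} ψ dμ_{G/L}` for every Borel `ψ : G ⧸ L → [0, ∞]`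
(Gelbart (1975), (9.13): `∫_{Γ(γ)\G} = vol(Γ(γ)\G_γ) ∫_{G_γ\G}` for fibre-constant integrands).
[cite: Gelbart1975, (9.13)] -/
theorem exists_lintegral_comp_quotientMapOfLE_eq_mul_lintegral (hHL : H ≤ L)
    [CompactSpace (L ⧸ H.subgroupOf L)] (hGH : μGH ≠ 0) (hGL : μGL ≠ 0) :
    ∃ v : ℝ≥0∞, v ≠ 0 ∧ v ≠ ∞ ∧ ∀ ψ : G ⧸ L → ℝ≥0∞, Measurable ψ →
      ∫⁻ x, ψ (Subgroup.quotientMapOfLE hHL x) ∂μGH = v * ∫⁻ y, ψ y ∂μGL := by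
  obtain ⟨v, hv0, hv⟩ := exists_map_quotientMapOfLE_eq_smul H L μGH μGL hHL hGH hGL
  exact ⟨v, ENNReal.coe_ne_zero.2 hv0, ENNReal.coe_ne_top, fun ψ hψ =>
    lintegral_comp_quotientMapOfLE_eq H L μGH μGL hHL hv hψ⟩

end CompactFibre

end Literature.MeasureTheory.Group
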